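import Summits.BirchSwinnertonDyer.BirchSwinnertonDyer.Theorems.ResidualThetaTransportAtTwoThetaLayerLambdaCongruenceAtTwoCuspSpanArtinWitness
import Summits.BirchSwinnertonDyer.BirchSwinnertonDyer.Theorems.ResidualThetaTransportAtTwoSignedMuVanishingAtTwoPlusCuspSpanMersenne
import HarnessLib

/-!
# Route `ResidualThetaTransportAtTwo`, crux Kμ⁺ `SignedMuVanishingAtTwoPlus` (stmt-BirchSwinnertonDyer-20689), node (G″)_N
# (`CuspSpanEvenAtTwo N`, item 27436): the SINGLE-LAYER form and the PRINCIPAL-CONGRUENCE form of the node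

Cell `bsd-wall`, width seat `bsd-wall-rtt-p4-w2` (g6). THEOREMS ONLY (no `def`, no named fact, no `sorry`); helper `--supports` the
crux; closes nothing; BSD is not proved by this. Route-independent (no `Theses` import).

Exact 𝔽₂ Manin-symbol numerics of this seat (`Cruxes/SignedMuVanishingAtTwoPlus/MersenneChain.md`: the chain `4^n − 1` up to `65535`,
all 228 odd levels `3000 < N ≤ 70000` with `ord_N(4) ≤ 20`, `ψ(N) ≤ 1.5·10⁵`, and 40+ habitat⁺ conductors) show that at every tested level
ONE deep layer of `4^k`-classes already spans the kernel of the Shimura map. This file states that sharpening in the kernel and proves the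
(trivial) implications, plus the observation that at a RESONANT layer (`N ∣ 4^k − 1`) the `4^k`-elements are parabolic translates of
PRINCIPAL-CONGRUENCE elements:

* §1 `mul_mem_Gamma_of_apply_one_one_eq_four_pow` — if `N ∣ 4^k − 1` and `γ = (a b; c 4^k) ∈ Γ₀(N)` then `γ · T^{−b} ∈ Γ(N)`
  (`a ≡ 1`, `c ≡ 0`, `4^k ≡ 1 (mod N)`); `chi_eq_of_resonant_layer` — so an additive `χ` killing `T^{−b}` takes the same value on `γ` and on
  the principal-congruence element `γ T^{−b}`;
* §2 `forall_gamma1_of_forall_gamma` / `cuspSpanTrace_of_forall_gamma` — an additive `χ : Γ₀(N) → ZMod 2` killing the parabolics `T^b` and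
  every element of `Γ(N)` kills `Γ₁'(N)`, hence is `ψ ∘ d̄` (rtt-p3-w5's fibre bookkeeping): the conclusion of the node is EQUIVALENT to
  «`χ` kills `Γ(N)`», i.e. `K_N` is the image of `Γ(N)`;
* §3 `cuspSpanTrace_of_singleLayer` — the single-layer form (S_{N,k}), `k ≥ 1`: «every additive `χ` killing the elements of trace
  `0, ±1, ±2` and the elements with lower-right entry `±4^k` (THIS `k` only) is `ψ ∘ d̄`» implies the trace form (G″)_N;
  `forall_cuspSpanEvenAtTwo_of_singleLayer_mersenne` — (S_{4^n − 1, n}) for all `n ≥ B` implies `CuspSpanEvenAtTwo N` for every odd `N`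
  (this seat's Mersenne reduction `cuspSpanEvenAtTwo_of_mersenne`, p636247).

Nothing here asserts (S); it is a HYPOTHESIS spelled inline (numerically: true at every tested level, at the resonant layer and at
every deeper layer; the fixed-denominator `𝔽₂` case of Mazur–Rubin residual equidistribution — open, only averaged versions are in print).

References: A. W. Knapp, *Elliptic curves* (1992) Prop. 11.22 [Knapp1993]; R. Pollack, Duke Math. J. 118 (2003) Conj. 6.3 [Pollack2003];
B. Mazur, K. Rubin, *Arithmetic conjectures suggested by the statistical behavior of modular symbols*, Exp. Math. (2021) [MazurRubin2021Stats].
-/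

set_option autoImplicit false
-- justification: the `Summit.BirchSwinnertonDyer.BirchSwinnertonDyer.…` path repeats a component (route-file convention)
set_option linter.dupNamespace false

noncomputable section

open scoped MatrixGroups

open CongruenceSubgroup

namespace Summit.BirchSwinnertonDyer.BirchSwinnertonDyer.Theorems.SignedMuAtTwo

/-! ## §1. At a resonant layer the `4^k`-elements are parabolic translates of principal-congruence elements -/

section Resonant

variable {N : ℕ}

/-- **Resonant layer ⟹ principal congruence.** If `N ∣ 4^k − 1` and `γ = (a b; c d) ∈ Γ₀(N)` has `d = 4^k`, then for the parabolic
`P = (1, −b; 0, 1) ∈ Γ₀(N)` the product `γ P = (a, b(1 − a); c, d − bc)` lies in the principal congruence subgroup `Γ(N)`: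
`c ≡ 0`, `d = 4^k ≡ 1`, hence `a ≡ ad − bc = 1 (mod N)`. [folklore] -/
theorem mul_mem_Gamma_of_apply_one_one_eq_four_pow {k : ℕ} (hN : (N : ℤ) ∣ 4 ^ k - 1)
    (γ P : Gamma0 N) (hd : (γ : SL(2, ℤ)) 1 1 = 4 ^ k)
    (hP00 : (P : SL(2, ℤ)) 0 0 = 1) (hP01 : (P : SL(2, ℤ)) 0 1 = -(γ : SL(2, ℤ)) 0 1)
    (hP10 : (P : SL(2, ℤ)) 1 0 = 0) (hP11 : (P : SL(2, ℤ)) 1 1 = 1) :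
    ((γ * P : Gamma0 N) : SL(2, ℤ)) ∈ Gamma N := by
  set a : ℤ := (γ : SL(2, ℤ)) 0 0 with ha
  set b : ℤ := (γ : SL(2, ℤ)) 0 1 with hb
  set c : ℤ := (γ : SL(2, ℤ)) 1 0 with hc
  set d : ℤ := (γ : SL(2, ℤ)) 1 1 with hdd
  have hdet : a * d - b * c = 1 := by
    have h := Matrix.det_fin_two (γ : SL(2, ℤ)).1
    rw [(γ : SL(2, ℤ)).2] at h
    exact h.symm
  have hcN : ((c : ℤ) : ZMod N) = 0 := by
    have h := γ.2
    rw [Gamma0_mem] at h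
    exact_mod_cast h
  have h4 : (((4 : ℤ) ^ k : ℤ) : ZMod N) = 1 := by
    have h0 : (((4 : ℤ) ^ k - 1 : ℤ) : ZMod N) = 0 := (ZMod.intCast_zmod_eq_zero_iff_dvd _ N).mpr hN
    have : (((4 : ℤ) ^ k : ℤ) : ZMod N) - 1 = 0 := by exact_mod_cast h0
    exact sub_eq_zero.mp this
  have hdN : ((d : ℤ) : ZMod N) = 1 := by
    have e : d = 4 ^ k := hd
    rw [e]; exact h4
  have haN : ((a : ℤ) : ZMod N) = 1 := by
    have h := congrArg (fun z : ℤ ↦ (z : ZMod N)) hdet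
    simp only [Int.cast_sub, Int.cast_mul, Int.cast_one] at h
    rw [hdN, hcN, mul_one, mul_zero, sub_zero] at h
    exact h
  -- entries of the product
  have e00 : ((γ * P : Gamma0 N) : SL(2, ℤ)) 0 0 = a := by
    rw [gamma0_mul_apply_zero_zero', hP00, hP10]; ring
  have e01 : ((γ * P : Gamma0 N) : SL(2, ℤ)) 0 1 = b * (1 - a) := by
    rw [gamma0_mul_apply_zero_one, hP01, hP11]; ring
  have e10 : ((γ * P : Gamma0 N) : SL(2, ℤ)) 1 0 = c := by
    rw [ThetaLayerLambdaCongruenceAtTwo.gamma0_mul_apply_one_zero, hP00, hP10]; ring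
  have e11 : ((γ * P : Gamma0 N) : SL(2, ℤ)) 1 1 = d - c * b := by
    rw [gamma0_mul_apply_one_one', hP01, hP11]; ring
  rw [Gamma_mem]
  refine ⟨?_, ?_, ?_, ?_⟩
  · rw [e00]; exact haN
  · rw [e01]; push_cast; rw [haN]; ring
  · rw [e10]; exact hcN
  · rw [e11]; push_cast; rw [hdN, hcN]; ring

/-- **The value of an additive `χ` on a resonant `4^k`-element is its value on a principal-congruence element**: with `N ∣ 4^k − 1`,
`γ ∈ Γ₀(N)`, `d(γ) = 4^k`, and `χ` additive killing the parabolics `(1 x; 0 1)`, there is `g ∈ Γ₀(N)` with `g ∈ Γ(N)` (as an element of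
`SL(2, ℤ)`) and `χ γ = χ g` (namely `g = γ · (1, −b; 0, 1)`). [folklore] -/
theorem chi_eq_of_resonant_layer {χ : Gamma0 N → ZMod 2} {k : ℕ} (hN : (N : ℤ) ∣ 4 ^ k - 1)
    (hadd : ∀ γ δ : Gamma0 N, χ (γ * δ) = χ γ + χ δ)
    (hT : ∀ P : Gamma0 N, (P : SL(2, ℤ)) 0 0 = 1 → (P : SL(2, ℤ)) 1 0 = 0 → (P : SL(2, ℤ)) 1 1 = 1 → χ P = 0)
    (γ : Gamma0 N) (hd : (γ : SL(2, ℤ)) 1 1 = 4 ^ k) :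
    ∃ g : Gamma0 N, ((g : Gamma0 N) : SL(2, ℤ)) ∈ Gamma N ∧ χ γ = χ g := by
  obtain ⟨P, hP00, hP01, hP10, hP11⟩ :=
    ThetaLayerLambdaCongruenceAtTwo.exists_gamma0_entries (N := N) 1 (-(γ : SL(2, ℤ)) 0 1) 0 1 (by ring) (dvd_zero _)
  refine ⟨γ * P, mul_mem_Gamma_of_apply_one_one_eq_four_pow hN γ P hd hP00 hP01 hP10 hP11, ?_⟩
  rw [hadd, hT P hP00 hP10 hP11, add_zero]

end Resonant

/-! ## §2. «`χ` kills `Γ(N)`» is the conclusion of the node -/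

section GammaForm

variable {N : ℕ}

/-- An additive `χ : Γ₀(N) → ZMod 2` killing the parabolics `(1 x; 0 1)` and every element of `Γ₀(N)` that lies in the principal
congruence subgroup `Γ(N)` kills `Γ₁'(N)`: for `γ = (a b; c d)` with `d ≡ 1 (mod N)` the product `γ · (1, −b; 0, 1)` is in `Γ(N)`
(`a ≡ ad − bc = 1`, `b(1 − a) ≡ 0`, `d − bc ≡ 1`). [cite: Knapp1993, Prop. 11.22] -/
theorem forall_gamma1_of_forall_gamma {χ : Gamma0 N → ZMod 2}
    (hadd : ∀ γ δ : Gamma0 N, χ (γ * δ) = χ γ + χ δ)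
    (hT : ∀ P : Gamma0 N, (P : SL(2, ℤ)) 0 0 = 1 → (P : SL(2, ℤ)) 1 0 = 0 → (P : SL(2, ℤ)) 1 1 = 1 → χ P = 0)
    (hΓ : ∀ g : Gamma0 N, ((g : Gamma0 N) : SL(2, ℤ)) ∈ Gamma N → χ g = 0) :
    ∀ γ : Gamma0 N, γ ∈ Gamma1' N → χ γ = 0 := by
  intro γ hγ
  set a : ℤ := (γ : SL(2, ℤ)) 0 0 with ha
  set b : ℤ := (γ : SL(2, ℤ)) 0 1 with hb
  set c : ℤ := (γ : SL(2, ℤ)) 1 0 with hc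
  set d : ℤ := (γ : SL(2, ℤ)) 1 1 with hdd
  have hdet : a * d - b * c = 1 := by
    have h := Matrix.det_fin_two (γ : SL(2, ℤ)).1
    rw [(γ : SL(2, ℤ)).2] at h
    exact h.symm
  have hcN : ((c : ℤ) : ZMod N) = 0 := by
    have h := γ.2
    rw [Gamma0_mem] at h
    exact_mod_cast h
  have hdN : ((d : ℤ) : ZMod N) = 1 := by
    have h := hγ
    rw [Gamma1_mem'] at h
    exact h
  have haN : ((a : ℤ) : ZMod N) = 1 := by
    have h := congrArg (fun z : ℤ ↦ (z : ZMod N)) hdet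
    simp only [Int.cast_sub, Int.cast_mul, Int.cast_one] at h
    rw [hdN, hcN, mul_one, mul_zero, sub_zero] at h
    exact h
  obtain ⟨P, hP00, hP01, hP10, hP11⟩ :=
    ThetaLayerLambdaCongruenceAtTwo.exists_gamma0_entries (N := N) 1 (-b) 0 1 (by ring) (dvd_zero _)
  have e00 : ((γ * P : Gamma0 N) : SL(2, ℤ)) 0 0 = a := by
    rw [gamma0_mul_apply_zero_zero', hP00, hP10]; ring
  have e01 : ((γ * P : Gamma0 N) : SL(2, ℤ)) 0 1 = b * (1 - a) := by
    rw [gamma0_mul_apply_zero_one, hP01, hP11]; ring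
  have e10 : ((γ * P : Gamma0 N) : SL(2, ℤ)) 1 0 = c := by
    rw [ThetaLayerLambdaCongruenceAtTwo.gamma0_mul_apply_one_zero, hP00, hP10]; ring
  have e11 : ((γ * P : Gamma0 N) : SL(2, ℤ)) 1 1 = d - c * b := by
    rw [gamma0_mul_apply_one_one', hP01, hP11]; ring
  have hmem : ((γ * P : Gamma0 N) : SL(2, ℤ)) ∈ Gamma N := by
    rw [Gamma_mem]
    refine ⟨?_, ?_, ?_, ?_⟩
    · rw [e00]; exact haN
    · rw [e01]; push_cast; rw [haN]; ring
    · rw [e10]; exact hcN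
    · rw [e11]; push_cast; rw [hdN, hcN]; ring
  have h1 : χ (γ * P) = 0 := hΓ _ hmem
  rw [hadd, hT P hP00 hP10 hP11, add_zero] at h1
  exact h1

/-- **The Γ(N)-form of the node's conclusion.** An additive `χ : Γ₀(N) → ZMod 2` killing the parabolics `(1 x; 0 1)` and every element
of `Γ₀(N) ∩ Γ(N)` is `ψ ∘ d̄` with `ψ` multiplicative on units (§2 + rtt-p3-w5's `exists_mulChar_of_forall_gamma1`). So, for characters
killing the small-trace elements, the conclusion of (G″)_N / `CuspSpanEvenAtTwo N` is EQUIVALENT to «`χ` kills `Γ(N)`» — dually, the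
kernel of the Shimura map on `H₁(X₀(N); 𝔽₂)` is the image of `Γ(N)`. [cite: Knapp1993, Prop. 11.22] -/
theorem cuspSpanTrace_of_forall_gamma [NeZero N] {χ : Gamma0 N → ZMod 2}
    (hadd : ∀ γ δ : Gamma0 N, χ (γ * δ) = χ γ + χ δ)
    (hT : ∀ P : Gamma0 N, (P : SL(2, ℤ)) 0 0 = 1 → (P : SL(2, ℤ)) 1 0 = 0 → (P : SL(2, ℤ)) 1 1 = 1 → χ P = 0)
    (hΓ : ∀ g : Gamma0 N, ((g : Gamma0 N) : SL(2, ℤ)) ∈ Gamma N → χ g = 0) :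
    ∃ ψ : ZMod N → ZMod 2, (∀ x y : ZMod N, IsUnit x → IsUnit y → ψ (x * y) = ψ x + ψ y) ∧
      ∀ γ : Gamma0 N, χ γ = ψ ((((γ : SL(2, ℤ)) 1 1 : ℤ) : ZMod N)) :=
  exists_mulChar_of_forall_gamma1 hadd (forall_gamma1_of_forall_gamma hadd hT hΓ)

/-- Conversely (trivially), `ψ ∘ d̄` kills every element of `Γ(N)` when `ψ 1 = 0`, which holds for `ψ` multiplicative on units.
[folklore] -/
theorem forall_gamma_of_mulChar [NeZero N] {χ : Gamma0 N → ZMod 2} {ψ : ZMod N → ZMod 2}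
    (hψ : ∀ x y : ZMod N, IsUnit x → IsUnit y → ψ (x * y) = ψ x + ψ y)
    (hχ : ∀ γ : Gamma0 N, χ γ = ψ ((((γ : SL(2, ℤ)) 1 1 : ℤ) : ZMod N))) :
    ∀ g : Gamma0 N, ((g : Gamma0 N) : SL(2, ℤ)) ∈ Gamma N → χ g = 0 := by
  intro g hg
  rw [Gamma_mem] at hg
  have hψ1 : ψ 1 = 0 := by
    have h := hψ 1 1 isUnit_one isUnit_one
    rw [mul_one] at h
    -- `x = x + x` forces `x = 0` in `ZMod 2`
    revert h
    generalize ψ 1 = x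
    decide +revert
  rw [hχ g]
  have : ((((g : Gamma0 N) : SL(2, ℤ)) 1 1 : ℤ) : ZMod N) = 1 := hg.2.2.2
  rw [this, hψ1]

end GammaForm

/-! ## §3. The single-layer form (S_{N,k}) and its consequences -/

section SingleLayer

variable {N : ℕ}

/-- **(S_{N,k}) ⟹ (G″)_N.** If, for some fixed `k ≥ 1`, every additive `χ : Γ₀(N) → ZMod 2` killing the elements of trace `0, ±1, ±2` and
the elements with lower-right entry `±4^k` is `ψ ∘ d̄`, then the trace form (G″)_N holds (a character killing all `4^j`-classes kills the
`4^k`-classes). (S_{N,k}) is OPEN; numerically it holds at every tested level as soon as layer `k` has `≳ 2g` classes. [cite: Pollack2003, Conj. 6.3] -/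
theorem cuspSpanTrace_of_singleLayer {k : ℕ} (hk : 1 ≤ k)
    (hS : ∀ χ : Gamma0 N → ZMod 2,
      (∀ γ δ : Gamma0 N, χ (γ * δ) = χ γ + χ δ) →
      (∀ γ : Gamma0 N, ((γ : SL(2, ℤ)) 0 0 + (γ : SL(2, ℤ)) 1 1).natAbs ≤ 2 → χ γ = 0) →
      (∀ γ : Gamma0 N, ((γ : SL(2, ℤ)) 1 1).natAbs = 4 ^ k → χ γ = 0) →
      ∃ ψ : ZMod N → ZMod 2, (∀ x y : ZMod N, IsUnit x → IsUnit y → ψ (x * y) = ψ x + ψ y) ∧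
        ∀ γ : Gamma0 N, χ γ = ψ ((((γ : SL(2, ℤ)) 1 1 : ℤ) : ZMod N))) :
    ∀ χ : Gamma0 N → ZMod 2,
      (∀ γ δ : Gamma0 N, χ (γ * δ) = χ γ + χ δ) →
      (∀ γ : Gamma0 N, ((γ : SL(2, ℤ)) 0 0 + (γ : SL(2, ℤ)) 1 1).natAbs ≤ 2 → χ γ = 0) →
      (∀ γ : Gamma0 N, (∃ j : ℕ, 1 ≤ j ∧ ((γ : SL(2, ℤ)) 1 1).natAbs = 4 ^ j) → χ γ = 0) →
      ∃ ψ : ZMod N → ZMod 2, (∀ x y : ZMod N, IsUnit x → IsUnit y → ψ (x * y) = ψ x + ψ y) ∧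
        ∀ γ : Gamma0 N, χ γ = ψ ((((γ : SL(2, ℤ)) 1 1 : ℤ) : ZMod N)) :=
  fun χ hadd hsmall hkill ↦ hS χ hadd hsmall (fun γ hγ ↦ hkill γ ⟨k, hk, hγ⟩)

/-- **(S_{N,k}) ⟹ the named node `CuspSpanEvenAtTwo N`** (`cuspSpanTrace_of_singleLayer` + rtt-p4-w3's `cuspSpanEvenAtTwo_of_cuspSpanTrace`).
[cite: Pollack2003, Conj. 6.3] -/
theorem cuspSpanEvenAtTwo_of_singleLayer [NeZero N] {k : ℕ} (hk : 1 ≤ k)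
    (hS : ∀ χ : Gamma0 N → ZMod 2,
      (∀ γ δ : Gamma0 N, χ (γ * δ) = χ γ + χ δ) →
      (∀ γ : Gamma0 N, ((γ : SL(2, ℤ)) 0 0 + (γ : SL(2, ℤ)) 1 1).natAbs ≤ 2 → χ γ = 0) →
      (∀ γ : Gamma0 N, ((γ : SL(2, ℤ)) 1 1).natAbs = 4 ^ k → χ γ = 0) →
      ∃ ψ : ZMod N → ZMod 2, (∀ x y : ZMod N, IsUnit x → IsUnit y → ψ (x * y) = ψ x + ψ y) ∧
        ∀ γ : Gamma0 N, χ γ = ψ ((((γ : SL(2, ℤ)) 1 1 : ℤ) : ZMod N))) :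
    CuspSpanEvenAtTwo N :=
  cuspSpanEvenAtTwo_of_cuspSpanTrace (cuspSpanTrace_of_singleLayer hk hS)

/-- **The resonant single-layer form along the Mersenne chain ⟹ the node at EVERY odd level.** If for every `n ≥ B` the single-layer
statement (S_{4^n − 1, n}) holds — every additive `χ : Γ₀(4^n − 1) → ZMod 2` killing the elements of trace `0, ±1, ±2` and the elements
with lower-right entry `±4^n` (the layer whose elements are `≡ T^b (mod 4^n − 1)`, §1) is `ψ ∘ d̄` — then `CuspSpanEvenAtTwo N` holds for
every odd `N` (`cuspSpanTrace_of_singleLayer` + this seat's Mersenne reduction `cuspSpanEvenAtTwo_of_mersenne`, p636247). Conditional;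
nothing is asserted. [cite: Pollack2003, Conj. 6.3] -/
theorem forall_cuspSpanEvenAtTwo_of_singleLayer_mersenne (B : ℕ)
    (hS : ∀ n : ℕ, B ≤ n → ∀ χ : Gamma0 (4 ^ n - 1) → ZMod 2,
      (∀ γ δ : Gamma0 (4 ^ n - 1), χ (γ * δ) = χ γ + χ δ) →
      (∀ γ : Gamma0 (4 ^ n - 1), ((γ : SL(2, ℤ)) 0 0 + (γ : SL(2, ℤ)) 1 1).natAbs ≤ 2 → χ γ = 0) →
      (∀ γ : Gamma0 (4 ^ n - 1), ((γ : SL(2, ℤ)) 1 1).natAbs = 4 ^ n → χ γ = 0) →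
      ∃ ψ : ZMod (4 ^ n - 1) → ZMod 2, (∀ x y : ZMod (4 ^ n - 1), IsUnit x → IsUnit y → ψ (x * y) = ψ x + ψ y) ∧
        ∀ γ : Gamma0 (4 ^ n - 1), χ γ = ψ ((((γ : SL(2, ℤ)) 1 1 : ℤ) : ZMod (4 ^ n - 1)))) :
    ∀ (N : ℕ) [NeZero N], ¬ 2 ∣ N → CuspSpanEvenAtTwo N := by
  intro N _ hN
  refine cuspSpanEvenAtTwo_of_mersenne (max B 1) (fun n hn ↦ ?_) N hN
  exact cuspSpanTrace_of_singleLayer (le_trans (le_max_right B 1) hn) (hS n (le_trans (le_max_left B 1) hn))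

end SingleLayer

end Summit.BirchSwinnertonDyer.BirchSwinnertonDyer.Theorems.SignedMuAtTwo

end
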